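/-
Copyright (c) 2026 the pub-hodgecm-mathlib formalisation cell (harness21).  Prover seat hodgecm-mathlib-K2E1-p15 (g0), Track B ∕ K2-LIT «5Res (b) BL-2(χ,τ)», h413 =
`stmt-HodgeConjecture-24833`, line `K2_E1_TraceFormulaBeta`, route of record `HCCMUnconditional`; payer offered on the K2 bus 2026-09-04T11:24Z for row 12b's letter
`hα₁d`∕`hα₂d` (K2E1-p10 (g2) census 11:22:00Z (a): «holomorphy of `z ↦ toHN (φ·H^z)` for bounded φ is row 13∕X1_χ's payer — not ★ for non-constant φ»).
-/
import Summits.HodgeConjecture.HodgeConjecture.Theorems.K2E1BLHeightPowerHolomorphicU2   -- ★ ℓ7 (K2E3-p12): `differentiableOn_of_weighted_bound`, `memLp_borelQuotHeight_rpow_add_rpow`, `borelQuotHeight_pos`, `norm_ofReal_cpow_le_rpow_add_rpow`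
import Summits.HodgeConjecture.HodgeConjecture.Theorems.K2E1BLInvariantSigmaDescentU     -- ★ (K2-defs1): `measurable_zFun_of_measurable` (Borel descent of `B(F)`-invariant Borel functions to `Z`)
import Summits.HodgeConjecture.HodgeConjecture.Theorems.K2E1BorelEisensteinUDefs         -- ★ `flatSectionU`
import HarnessLib

/-!
# K2·E1 — `K2E1ChiFlatSectionHNHolomorphicU2`: THE `(χ, τ)` CONSTANT-TERM VECTORS `α₁(z) = [f_z^φ]|_{Z_c}`, `α₂(z) = [f_{1−z}^{φ′}]|_{Z_c}` ARE HOLOMORPHIC FAMILIES IN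
# `𝓗_k(Z_c)` FOR BOUNDED SECTIONS — the print `H^z ↦ φ̃·H^z` of ★ `K2E1BLHeightPowerHolomorphicU2` [arXiv:1911.02342, §4 Claim 5, p. 10]

Track B ∕ K2-LIT, crux h413 = `stmt-HodgeConjecture-24833`; cell `hodgecm-mathlib`, squad K2, ENGINE E1, campaign «5Res», road «BL-2(χ,τ) ∘ MS-2(χ,τ) ∘ ARCH-UNITARITY ∘ R8₂»
(SHEET rows 11–13).  THEOREMS ONLY (no `def`, no `instance`, no notation, no named-fact hypothesis, no `sorry`); lane `--kind proof --supports stmt-HodgeConjecture-24833 --as helper`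
(count-neutral).  Closes no socket.

WHY.  The `(χ, τ)` 𝔛-system of one ball (★ row 11b `K2E1BLXSystemPackageFinDimU.exists_xSystem_finDim`, row 12b `K2E1ChiEisensteinMeromorphicBallU2`) carries the constant-term vectors
`α₁(z) = [f_z^φ]` and `L z b = Σ_j b_j • [f_{1−z}^{φ′_j}]` (`φ ∈ V(χ, τ, U)`, `φ′_j` a basis of `V(χʷ, τ, U)`, ★ p859551) INSIDE the holomorphic operator `A z`; Bernstein–Lapid's Thm 2.3 needs
them holomorphic as `𝓗_k(Z_c)`-valued maps.  The spherical letter ℓ7 ★ `differentiableOn_HN_of_ae_eq_cpow_self ∕ _one_sub` treats `H^z`; here the section is `φ̃·H^z` with `φ̃ = zFun φ`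
BOUNDED (`‖φ‖ ≤ M`) and Borel on `Z` (★ `measurable_zFun_of_measurable` for Borel left-`B(F)`-invariant `φ`), so the same weighted domination `‖φ̃(x)H(x)^{w}‖ ≤ M·(H^{σ₀} + H^{σ₁})`
(★ `differentiableOn_of_weighted_bound`, `H^{σ₀} + H^{σ₁} ∈ 𝓗_k(Z_c)` for `σ₀, σ₁ ≤ k` ★) gives holomorphy.
* §1 (generic measure space) **`differentiableOn_Lp_mul_cpow`** — `F z =ᵐ ψ·H^{φ(z)}` with `ψ` bounded a.e.-strongly measurable, `H > 0` measurable, `H^{σ₀} + H^{σ₁} ∈ L²`, `σ₀ ≤ Re φ ≤ σ₁`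
  ⟹ `DifferentiableOn ℂ F U`.
* §2 (`Z = B(F)∖G(𝔸)`) `zFun_flatSectionU` (`zFun (flatSectionU φ z) = zFun φ · HZ^z`, pointwise), `norm_zFun_le`, **`differentiableOn_HN_of_ae_eq_mul_cpow`** (bounded Borel `ψ` on `Z`),
  and the two row-12b letters **`differentiableOn_HN_of_ae_eq_zFun_flatSectionU`** (`α z =ᵐ zFun (flatSectionU φ z)` on `U ⊆ {σ₀ ≤ Re ≤ σ₁}` ⟹ holomorphic: `hα₁d`) and
  **`differentiableOn_HN_of_ae_eq_zFun_flatSectionU_one_sub`** (`α z =ᵐ zFun (flatSectionU φ′ (1 − z))`: `hα₂d`, each coordinate of `L z`).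

HONEST LABEL: HC_CM is proved only modulo the 7 printed citations (2 remaining named inputs: hLiu418 = `stmt-HodgeConjecture-24832`, h413 = `stmt-HodgeConjecture-24833`) until rung 0
closes; this file asserts no named fact and closes no socket.

## References
* [BernsteinLapid2019] J. Bernstein, E. Lapid, *On the meromorphic continuation of Eisenstein series*, arXiv:1911.02342 (J. AMS 37 (2024), doi:10.1090/jams/1020), §4 Claim 5, p. 10.
* [Rudin1991] W. Rudin, *Functional Analysis* (2nd ed., 1991), Thm. 3.31 (vector-valued holomorphy).
* [MoeglinWaldspurger1995] C. Mœglin, J.-L. Waldspurger, *Spectral decomposition and Eisenstein series* (1995), I.2.13, II.1.5.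
-/

set_option autoImplicit false
set_option linter.dupNamespace false  -- the mandated namespace repeats the summit's segment (`HodgeConjecture.HodgeConjecture`)

noncomputable section

open MeasureTheory Filter Topology Set NumberField
open scoped ENNReal NNReal
open Literature.NumberTheory.Automorphic Literature.NumberTheory.Automorphic.UnitaryGroup
open Summit.HodgeConjecture.HodgeConjecture.Cruxes.H413.K2E1BorelEisensteinU
open Summit.HodgeConjecture.HodgeConjecture.Cruxes.H413.K2E1BLBorelSpacesU2Defs
open Summit.HodgeConjecture.HodgeConjecture.Cruxes.H413.K2E1BLIotaUnfoldingU (measurable_borelQuotHeight)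
open Summit.HodgeConjecture.HodgeConjecture.Cruxes.H413.K2E1BLHeightPowerHolomorphicU2 (differentiableOn_of_weighted_bound memLp_borelQuotHeight_rpow_add_rpow borelQuotHeight_pos norm_ofReal_cpow_le_rpow_add_rpow)
open Summit.HodgeConjecture.HodgeConjecture.Cruxes.H413.K2E1BLInvariantSigmaDescentU (measurable_zFun_of_measurable)

namespace Summit.HodgeConjecture.HodgeConjecture.Cruxes.H413.K2E1ChiFlatSectionHNHolomorphicU2

/-! ## §1 Bounded multiples of the power family are holomorphic into `L²` -/

section Weighted

variable {X : Type*} [MeasurableSpace X] {μ : Measure X}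

/-- **`z ↦ [ψ · H^{φ(z)}]` IS HOLOMORPHIC INTO `L²(μ)`** (generic): `H : X → ℝ` measurable and positive with `H^{σ₀} + H^{σ₁} ∈ L²(μ)`, `ψ : X → ℂ` a.e.-strongly measurable and BOUNDED
(`‖ψ‖ ≤ M`), `φ` holomorphic on the open `U` with `σ₀ ≤ Re φ(z) ≤ σ₁`, and `F : ℂ → L²(μ)` with `F z =ᵐ ψ · (H ·)^{φ z}` for `z ∈ U`; then `F` is complex differentiable on `U` (★
`differentiableOn_of_weighted_bound` with `C = max M 0`, `W = H^{σ₀} + H^{σ₁}`).  The print `H^{φ} ↦ ψ·H^{φ}` of ★ `differentiableOn_Lp_cpow`. [cite: BernsteinLapid2019, §4 Claim 5 and p. 10]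
[cite: Rudin1991, Thm 3.31] -/
theorem differentiableOn_Lp_mul_cpow {H : X → ℝ} (hHm : Measurable H) (hHpos : ∀ x, 0 < H x) {σ₀ σ₁ : ℝ} (hW : MemLp (fun x => H x ^ σ₀ + H x ^ σ₁) 2 μ)
    {ψ : X → ℂ} (hψm : AEStronglyMeasurable ψ μ) {M : ℝ} (hψM : ∀ x, ‖ψ x‖ ≤ M)
    {φ : ℂ → ℂ} {U : Set ℂ} (hU : IsOpen U) (hφ : DifferentiableOn ℂ φ U) (hφre : ∀ z ∈ U, σ₀ ≤ (φ z).re ∧ (φ z).re ≤ σ₁) {F : ℂ → Lp ℂ 2 μ}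
    (hF : ∀ z ∈ U, (F z : X → ℂ) =ᵐ[μ] fun x => ψ x * ((H x : ℝ) : ℂ) ^ φ z) : DifferentiableOn ℂ F U := by
  refine differentiableOn_of_weighted_bound (f := fun z x => ψ x * ((H x : ℝ) : ℂ) ^ φ z) hU (fun x => ?_) (fun z _ => ?_) hW (le_max_right M 0) (fun z hz x => ?_) hF
  · exact (hφ.const_cpow (Or.inl (Complex.ofReal_ne_zero.2 (hHpos x).ne'))).const_mul _
  · exact hψm.mul ((Complex.measurable_ofReal.comp hHm).pow_const (φ z)).aestronglyMeasurable
  · rw [norm_mul]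
    exact mul_le_mul ((hψM x).trans (le_max_left _ _)) (norm_ofReal_cpow_le_rpow_add_rpow (hHpos x) (hφre z hz).1 (hφre z hz).2) (norm_nonneg _) (le_max_right _ _)

end Weighted

/-! ## §2 The `(χ, τ)` constant-term vectors in `𝓗_k(Z_c)` -/

section BL

variable {F E : Type} [Field F] [NumberField F] [Field E] [NumberField E] [Algebra F E] {c : E ≃ₐ[F] E} {N : ℕ} [NeZero N]

/-- `HZ(x) = H(out x)` for any class `x ∈ Z` (the height descends, ★ `borelQuotHeight_toBorelQuotient`). [cite: BernsteinLapid2019, §4 p. 9] -/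
theorem borelQuotHeight_eq_borelHeight_out (x : borelQuotient F E c N) :
    borelQuotHeight F E c N x = borelHeight (Quotient.out (x : Quotient (MulAction.orbitRel (ratBorelSubgroup F E c N) (quasiSplit F E c N).Adelic))) := by
  have h := borelQuotHeight_toBorelQuotient F E c N (Quotient.out (x : Quotient (MulAction.orbitRel (ratBorelSubgroup F E c N) (quasiSplit F E c N).Adelic)))
  rwa [show toBorelQuotient F E c N (Quotient.out (x : Quotient (MulAction.orbitRel (ratBorelSubgroup F E c N) (quasiSplit F E c N).Adelic))) = x from Quotient.out_eq x] at h

/-- **`zFun (f_z^φ) = zFun φ · HZ^z` POINTWISE ON `Z`** (both sides read the same representative; the height descends). [cite: BernsteinLapid2019, §4 p. 10] [cite: MoeglinWaldspurger1995, II.1.5] -/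
theorem zFun_flatSectionU (φ : (quasiSplit F E c N).Adelic → ℂ) (z : ℂ) :
    zFun F E c N (flatSectionU φ z) = fun x => zFun F E c N φ x * (((borelQuotHeight F E c N x : ℝ≥0) : ℝ) : ℂ) ^ z := by
  funext x
  rw [borelQuotHeight_eq_borelHeight_out]
  rfl

omit [NeZero N] in
/-- A bound `‖φ‖ ≤ M` descends: `‖zFun φ x‖ ≤ M`. [folklore] -/
theorem norm_zFun_le {φ : (quasiSplit F E c N).Adelic → ℂ} {M : ℝ} (hφM : ∀ g, ‖φ g‖ ≤ M) (x : borelQuotient F E c N) : ‖zFun F E c N φ x‖ ≤ M :=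
  hφM _

/-- **A BOUNDED BOREL MULTIPLE OF THE POWER FAMILY IS HOLOMORPHIC IN `𝓗_k(Z_c)`**: any `α : ℂ → 𝓗_k(Z_c)` with `α z =ᵐ ψ · HZ^{φ(z)}` on an open `U`, `ψ : Z → ℂ` a.e.-strongly measurable and
bounded, `φ` holomorphic on `U` with `σ₀ ≤ Re φ ≤ σ₁`, `σ₀, σ₁ ≤ k`, `μZ(Z_c) < ∞`, is HOLOMORPHIC on `U` (§1 on `𝓗_k(Z_c) = L²(HZ^{−2k}μZ|_{c < HZ})`, weight ★ `memLp_borelQuotHeight_rpow_add_rpow`).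
[cite: BernsteinLapid2019, §4 Claim 5 and p. 10] [cite: Rudin1991, Thm 3.31] -/
theorem differentiableOn_HN_of_ae_eq_mul_cpow {k : ℕ} {c₁ : ℝ≥0} (hc₁ : 0 < c₁) {μZ : Measure (borelQuotient F E c N)} (hfin : μZ {z | c₁ < borelQuotHeight F E c N z} ≠ ∞)
    {σ₀ σ₁ : ℝ} (hσ₀ : σ₀ ≤ k) (hσ₁ : σ₁ ≤ k) {ψ : borelQuotient F E c N → ℂ} (hψm : AEStronglyMeasurable ψ (weightedTruncMeasure F E c N k c₁ μZ)) {M : ℝ} (hψM : ∀ x, ‖ψ x‖ ≤ M)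
    {φ : ℂ → ℂ} {U : Set ℂ} (hU : IsOpen U) (hφ : DifferentiableOn ℂ φ U) (hφre : ∀ z ∈ U, σ₀ ≤ (φ z).re ∧ (φ z).re ≤ σ₁)
    {α : ℂ → HN F E c N k c₁ μZ}
    (hα : ∀ z ∈ U, (α z : borelQuotient F E c N → ℂ) =ᵐ[weightedTruncMeasure F E c N k c₁ μZ] fun x => ψ x * (((borelQuotHeight F E c N x : ℝ≥0) : ℝ) : ℂ) ^ φ z) :
    DifferentiableOn ℂ α U :=
  differentiableOn_Lp_mul_cpow measurable_borelQuotHeight.coe_nnreal_real borelQuotHeight_pos (memLp_borelQuotHeight_rpow_add_rpow hc₁ hfin hσ₀ hσ₁) hψm hψM hU hφ hφre hα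

variable [MeasurableSpace (quasiSplit F E c N).Adelic] [BorelSpace (quasiSplit F E c N).Adelic]

/-- **ROW 12b's LETTER `hα₁d` — `α₁(z) = [f_z^φ]|_{Z_c}` IS HOLOMORPHIC** for a BOUNDED Borel left-`B(F)`-invariant section `φ` (every `χ`-section, ★ `IsChiSection.toAdelic_mul`): any
`α : ℂ → 𝓗_k(Z_c)` with `α z =ᵐ zFun (flatSectionU φ z)` on an open `U ⊆ {σ₀ ≤ Re ≤ σ₁}`, `σ₀, σ₁ ≤ k`, `μZ(Z_c) < ∞`, is holomorphic on `U` (`zFun (f_z^φ) = zFun φ · HZ^z`, `zFun φ`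
Borel ★ and bounded). [cite: BernsteinLapid2019, §4 Claim 5 and p. 10] [cite: MoeglinWaldspurger1995, II.1.5] -/
theorem differentiableOn_HN_of_ae_eq_zFun_flatSectionU {k : ℕ} {c₁ : ℝ≥0} (hc₁ : 0 < c₁) {μZ : Measure (borelQuotient F E c N)} (hfin : μZ {z | c₁ < borelQuotHeight F E c N z} ≠ ∞)
    {σ₀ σ₁ : ℝ} (hσ₀ : σ₀ ≤ k) (hσ₁ : σ₁ ≤ k) {φ : (quasiSplit F E c N).Adelic → ℂ} (hφm : Measurable φ) (hφB : ∀ γ ∈ ratBorelSubgroup F E c N, ∀ g, φ (γ * g) = φ g)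
    {M : ℝ} (hφM : ∀ g, ‖φ g‖ ≤ M) {U : Set ℂ} (hU : IsOpen U) (hUre : ∀ z ∈ U, σ₀ ≤ z.re ∧ z.re ≤ σ₁)
    {α : ℂ → HN F E c N k c₁ μZ} (hα : ∀ z ∈ U, (α z : borelQuotient F E c N → ℂ) =ᵐ[weightedTruncMeasure F E c N k c₁ μZ] zFun F E c N (flatSectionU φ z)) :
    DifferentiableOn ℂ α U :=
  differentiableOn_HN_of_ae_eq_mul_cpow hc₁ hfin hσ₀ hσ₁ (measurable_zFun_of_measurable hφm hφB).aestronglyMeasurable (norm_zFun_le hφM) hU differentiableOn_id hUre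
    fun z hz => by rw [← zFun_flatSectionU]; exact hα z hz

/-- **ROW 12b's LETTER `hα₂d` — `α₂(z) = [f_{1−z}^{φ′}]|_{Z_c}` IS HOLOMORPHIC** (the coordinates of `L z` over a basis `φ′_j` of `V(χʷ, τ, U)`): as above with `α z =ᵐ zFun (flatSectionU φ′ (1 − z))`
on an open `U ⊆ {σ₀ ≤ 1 − Re ≤ σ₁}`. [cite: BernsteinLapid2019, §4 Claim 5 and p. 10] [cite: MoeglinWaldspurger1995, II.1.7] -/
theorem differentiableOn_HN_of_ae_eq_zFun_flatSectionU_one_sub {k : ℕ} {c₁ : ℝ≥0} (hc₁ : 0 < c₁) {μZ : Measure (borelQuotient F E c N)} (hfin : μZ {z | c₁ < borelQuotHeight F E c N z} ≠ ∞)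
    {σ₀ σ₁ : ℝ} (hσ₀ : σ₀ ≤ k) (hσ₁ : σ₁ ≤ k) {φ' : (quasiSplit F E c N).Adelic → ℂ} (hφm : Measurable φ') (hφB : ∀ γ ∈ ratBorelSubgroup F E c N, ∀ g, φ' (γ * g) = φ' g)
    {M : ℝ} (hφM : ∀ g, ‖φ' g‖ ≤ M) {U : Set ℂ} (hU : IsOpen U) (hUre : ∀ z ∈ U, σ₀ ≤ 1 - z.re ∧ 1 - z.re ≤ σ₁)
    {α : ℂ → HN F E c N k c₁ μZ} (hα : ∀ z ∈ U, (α z : borelQuotient F E c N → ℂ) =ᵐ[weightedTruncMeasure F E c N k c₁ μZ] zFun F E c N (flatSectionU φ' (1 - z))) :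
    DifferentiableOn ℂ α U :=
  differentiableOn_HN_of_ae_eq_mul_cpow (φ := fun z : ℂ => 1 - z) hc₁ hfin hσ₀ hσ₁ (measurable_zFun_of_measurable hφm hφB).aestronglyMeasurable (norm_zFun_le hφM) hU
    (differentiableOn_id.const_sub (1 : ℂ)) (fun z hz => by simpa only [Complex.sub_re, Complex.one_re] using hUre z hz)
    fun z hz => by rw [← zFun_flatSectionU]; exact hα z hz

end BL

end Summit.HodgeConjecture.HodgeConjecture.Cruxes.H413.K2E1ChiFlatSectionHNHolomorphicU2

end
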